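import Summits.FinalStateConjecture.FinalStateConjecture.Theorems.ClusterCompletenessAdiabaticMultiKerrILEDZerothOrderPointwise
import Summits.FinalStateConjecture.FinalStateConjecture.Theorems.ClusterCompletenessAdiabaticMultiKerrILEDSlabWeightedExhaustion

/-!
# Route ClusterCompleteness — crux `AdiabaticMultiKerrILED`, line `Sketch`:
# zeroth-order control — transport of `Φ²` inward from the far zone

Helper file for the crux `stmt-FinalStateConjecture-14310`
(`Summit.FinalStateConjecture.FinalStateConjecture.Theses.ClusterCompleteness.AdiabaticMultiKerrILED`),
line `Sketch`, stub `restFrame_zerothOrder_le` (lead c7, wave 8).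

Setting (one zone, zero spin, rest frame of the static tails-cut Schwarzschild zone,
`r = Kerr.radius 0 = ‖x⃗‖`): tilted leaves `{x⁰ = u + F(x⃗)}` of a `C²` height `F` with `‖dF‖ ≤ ½`,
a `C¹` function `Φ` (no wave equation is used), the tortoise derivative
`∂_{r*}Φ = (1 − μ)(x⃗·∇Φ)/r + μ∂₀Φ` of the tails-cut profile `μ = χ(2 − r/8M) · 2H`, and the far
cut-off `θ(r) = χ(6 − 2r/(3M))` of the pointwise file `…ZerothOrderPointwise`.

* `restFrame_zerothOrder_le` — **the registered stub**: `∫_{(0,s]} ∫_{2M<‖y‖≤15M/2} Φ²` over the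
  leaves is at most `K = 700` times `M ∫_{2M<‖y‖≤9M} Φ²` over the two boundary leaves plus
  `∫_{(0,s]} ∫_{15M/2≤‖y‖≤9M} Φ²` plus `M² ∫_{(0,s]} ∫_{2M<‖y‖≤9M} ((∂_{r*}Φ)² + (∂₀Φ)²)`.
  The pointwise transport inequality `θΦ² ≤ div V + bad₁ + bad₂` (`zeroth_transport_pointwise`)
  is multiplied by the static weight `Wt = χ(u₂/ε − 1)χ(2 − ‖x⃗‖²/(9M)²)` and integrated over the
  slab (all densities are continuous at `r > 2M`, so the weighted leaf integrals exist,
  `zeroth_leafIntegral`); `∫∫ Wt div V ≤ ½∫Wt|h|(leaf 0) + ½∫Wt|h|(leaf s)`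
  (`radialField_weighted_graph_le`, `h = 2(r−2M)θΦ² ≥ 0`, `= 0` for `r ≥ 9M`); the real integrals
  on the right are dominated by the Lebesgue integrals of the statement (`|h| ≤ 14MΦ²`,
  `bad₁ ≤ 38Φ²𝟙_{band}`, `bad₂ ≤ 648M²((∂_{r*}Φ)² + (∂₀Φ)²)`, `Wt ≤ 1`); finally
  `slab_lintegral_le_of_weighted_le` removes the weight (`ε ↓ 0`) and `θ = 1` on the core.

Dafermos–Rodnianski arXiv:0811.0354, §4.1.1; Dafermos–Rodnianski–Shlapentokh-Rothman
arXiv:1402.7034, §2.3.2 and §13.2. [folklore]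
-/

noncomputable section

-- the doubled `FinalStateConjecture.FinalStateConjecture` path component trips dupNamespace
set_option linter.dupNamespace false

open Set Filter Metric MeasureTheory
open scoped BigOperators Topology ENNReal
open Literature.Geometry.Lorentzian

namespace Summit.FinalStateConjecture.FinalStateConjecture.Theorems

/-! ### Measure-theoretic bricks -/

/-- `ofReal (∫ f) ≤ ∫⁻ ofReal ∘ f` for every real `f` (both sides discard the negative part; the
left side is `0` for non-integrable `f`). [folklore] -/
private theorem zeroth_ofReal_integral_le_lintegral {α : Type*} [MeasurableSpace α]
    {μ : Measure α} (f : α → ℝ) :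
    ENNReal.ofReal (∫ a, f a ∂μ) ≤ ∫⁻ a, ENNReal.ofReal (f a) ∂μ := by
  by_cases hf : Integrable f μ
  · calc ENNReal.ofReal (∫ a, f a ∂μ) ≤ ENNReal.ofReal (∫ a, max (f a) 0 ∂μ) :=
          ENNReal.ofReal_le_ofReal (integral_mono hf hf.pos_part fun a ↦ le_max_left _ _)
      _ = ∫⁻ a, ENNReal.ofReal (max (f a) 0) ∂μ :=
          ofReal_integral_eq_lintegral_ofReal hf.pos_part (Eventually.of_forall fun a ↦ le_max_right _ _)
      _ = ∫⁻ a, ENNReal.ofReal (f a) ∂μ := lintegral_congr fun a ↦ by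
          rcases le_total (f a) 0 with h | h
          · rw [max_eq_right h, ENNReal.ofReal_zero, ENNReal.ofReal_of_nonpos h]
          · rw [max_eq_left h]
  · rw [integral_undef hf, ENNReal.ofReal_zero]
    exact zero_le

/-- **From a weighted real leaf integral to a Lebesgue integral over a region**: if `f ≤ c G` on
`S` and `f ≤ 0` off `S` (`c ≥ 0`), then `ofReal (∫ f) ≤ c ∫⁻_S ofReal G`. [folklore] -/
theorem zeroth_ofReal_integral_le_mul {f G : E3 → ℝ} {S : Set E3} {c : ℝ} (hc : 0 ≤ c)
    (h1 : ∀ y ∈ S, f y ≤ c * G y) (h2 : ∀ y ∉ S, f y ≤ 0) :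
    ENNReal.ofReal (∫ y, f y) ≤ ENNReal.ofReal c * ∫⁻ y in S, ENNReal.ofReal (G y) := by
  refine (zeroth_ofReal_integral_le_lintegral f).trans ?_
  rw [← lintegral_const_mul' _ _ ENNReal.ofReal_ne_top]
  refine (lintegral_mono fun y ↦ ?_).trans (lintegral_indicator_le _ _)
  by_cases hy : y ∈ S
  · rw [indicator_of_mem hy, ← ENNReal.ofReal_mul hc]
    exact ENNReal.ofReal_le_ofReal (h1 y hy)
  · rw [indicator_of_notMem hy, ENNReal.ofReal_of_nonpos (h2 y hy)]

/-- **Slab version of `zeroth_ofReal_integral_le_mul`**: if `f u ≤ c G u` on `S` and `f u ≤ 0`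
off `S` for every `u` (`c ≥ 0`), then `ofReal (∫_{(0,s]} ∫ f) ≤ c ∫⁻_{(0,s]} ∫⁻_S ofReal G`.
[folklore] -/
theorem zeroth_ofReal_slabIntegral_le_mul {f G : ℝ → E3 → ℝ} {S : Set E3} {c : ℝ} (hc : 0 ≤ c)
    (h1 : ∀ u, ∀ y ∈ S, f u y ≤ c * G u y) (h2 : ∀ u, ∀ y ∉ S, f u y ≤ 0) (s : ℝ) :
    ENNReal.ofReal (∫ u in Ioc 0 s, ∫ y, f u y) ≤
      ENNReal.ofReal c * ∫⁻ u in Ioc 0 s, ∫⁻ y in S, ENNReal.ofReal (G u y) := by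
  refine (zeroth_ofReal_integral_le_lintegral _).trans ?_
  rw [← lintegral_const_mul' _ _ ENNReal.ofReal_ne_top]
  exact lintegral_mono fun u ↦ zeroth_ofReal_integral_le_mul hc (h1 u) (h2 u)

/-- **Leaf integrals of weighted densities**: for `P` continuous at the points with `r > 2M`
(`M, ε, R > 0`, `F` continuous), the weighted density `Wt P`, `Wt = χ(u₂/ε − 1) χ(2 − ‖x⃗‖²/R²)`,
is integrable on every leaf `{x⁰ = u + F(x⃗)}`, and its leaf integral is integrable in `u` over
`(0, s]` (`Wt P` is continuous on `ℝ⁴`, `continuous_tailsCutWeight_mul`, and vanishes for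
`‖y‖ > 2R`, so the leaf integral is continuous in `u`, `continuous_parametric_integral_of_continuous`).
[folklore] -/
theorem zeroth_leafIntegral {M ε R : ℝ} (hM : 0 < M) (hε : 0 < ε) (hR : 0 < R) {F : E3 → ℝ}
    (hF : Continuous F) {P : E4 → ℝ} (hP : ∀ x : E4, 2 * M < Kerr.radius 0 x → ContinuousAt P x)
    (s : ℝ) :
    (∀ u : ℝ, Integrable fun y : E3 ↦
      Real.smoothTransition (Kerr.horizonFn M 0 (E4.ofTimeSpace (u + F y) y) / ε - 1) *
        Real.smoothTransition (2 - E4.spatialNorm (E4.ofTimeSpace (u + F y) y) ^ 2 / R ^ 2) *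
        P (E4.ofTimeSpace (u + F y) y)) ∧
    IntegrableOn (fun u : ℝ ↦ ∫ y : E3,
      Real.smoothTransition (Kerr.horizonFn M 0 (E4.ofTimeSpace (u + F y) y) / ε - 1) *
        Real.smoothTransition (2 - E4.spatialNorm (E4.ofTimeSpace (u + F y) y) ^ 2 / R ^ 2) *
        P (E4.ofTimeSpace (u + F y) y)) (Ioc 0 s) := by
  set p : E4 → ℝ := fun x ↦ Real.smoothTransition (Kerr.horizonFn M 0 x / ε - 1) *
    Real.smoothTransition (2 - E4.spatialNorm x ^ 2 / R ^ 2) * P x with hp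
  set L : ℝ → E3 → E4 := fun u y ↦ E4.ofTimeSpace (u + F y) y with hL
  show (∀ u, Integrable fun y ↦ p (L u y)) ∧ IntegrableOn (fun u ↦ ∫ y, p (L u y)) (Ioc 0 s)
  have hpc : Continuous p := continuous_tailsCutWeight_mul R hM hε hP
  have hLc : Continuous fun z : ℝ × E3 ↦ L z.1 z.2 :=
    E4.continuous_ofTimeSpace' (continuous_fst.add (hF.comp continuous_snd)) continuous_snd
  have hLu : ∀ u, Continuous (L u) := fun u ↦
    E4.continuous_ofTimeSpace' (continuous_const.add hF) continuous_id
  have hzero : ∀ u y, y ∉ closedBall (0 : E3) (2 * R) → p (L u y) = 0 := by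
    intro u y hy
    rw [mem_closedBall_zero_iff, not_le] at hy
    have h2 : 2 * R ^ 2 < E4.spatialNorm (L u y) ^ 2 := by
      rw [hL]
      dsimp only
      rw [E4.spatialNorm_ofTimeSpace]
      nlinarith [norm_nonneg y]
    show _ * _ * _ = 0
    rw [tailsCutWeight_eq_zero_of_lt_spatialNorm_sq hR h2, zero_mul]
  refine ⟨fun u ↦ (hpc.comp (hLu u)).integrable_of_hasCompactSupport
    (HasCompactSupport.intro (isCompact_closedBall _ _) (hzero u)), ?_⟩
  have hball : ∀ u, ∫ y in closedBall (0 : E3) (2 * R), p (L u y) = ∫ y, p (L u y) :=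
    fun u ↦ setIntegral_eq_integral_of_forall_compl_eq_zero fun y hy ↦ hzero u y hy
  exact ((continuous_parametric_integral_of_continuous (f := fun (u : ℝ) (y : E3) ↦ p (L u y))
    (hpc.comp hLc) (isCompact_closedBall (0 : E3) (2 * R))).congr
      hball).integrableOn_Icc.mono_set Ioc_subset_Icc_self

/-! ### The registered stub -/

/-- **Zeroth-order control by transport from the far zone** (crux `stmt-FinalStateConjecture-14310`,
line `Sketch`, stub `restFrame_zerothOrder_le`): for `M > 0` there is `K` (`= 700`) such that for
every `C²` height `F` with `‖dF‖ ≤ ½`, every `C¹` function `Φ` and every `s ≥ 0`, the slab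
integral `∫_{(0,s]} ∫_{2M<‖y‖≤15M/2} Φ²` over the leaves `{x⁰ = u + F}` is at most `K` times
`M ∫_{2M<‖y‖≤9M} Φ²` over the two boundary leaves plus `∫_{(0,s]} ∫_{15M/2≤‖y‖≤9M} Φ²` plus
`M² ∫_{(0,s]} ∫_{2M<‖y‖≤9M} ((∂_{r*}Φ)² + (∂₀Φ)²)`: the weighted slab integral of the pointwise
transport inequality (`zeroth_transport_pointwise`, `radialField_weighted_graph_le`), the domination
of the right-hand real integrals by the Lebesgue integrals of the statement, and the exhaustion
`slab_lintegral_le_of_weighted_le`; if a right-hand integral is infinite the claim is trivial.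
Dafermos–Rodnianski arXiv:0811.0354, §4.1.1; DRSR arXiv:1402.7034, §2.3.2. [folklore] -/
theorem restFrame_zerothOrder_le : ∀ (M : ℝ), 0 < M → ∃ K : NNReal, ∀ (F : E3 → ℝ) (Φ : E4 → ℝ) (s : ℝ), ContDiff ℝ 2 F → (∀ y, ‖fderiv ℝ F y‖ ≤ 2⁻¹) → ContDiff ℝ 1 Φ → 0 ≤ s → ∫⁻ u in Set.Ioc 0 s, ∫⁻ y in {y : E3 | 2 * M < ‖y‖ ∧ ‖y‖ ≤ 15 * M / 2}, ENNReal.ofReal (Φ (E4.ofTimeSpace (u + F y) y) ^ 2) ≤ (K : ENNReal) * (ENNReal.ofReal M * (∫⁻ y in {y : E3 | 2 * M < ‖y‖ ∧ ‖y‖ ≤ 9 * M}, ENNReal.ofReal (Φ (E4.ofTimeSpace (0 + F y) y) ^ 2)) + ENNReal.ofReal M * (∫⁻ y in {y : E3 | 2 * M < ‖y‖ ∧ ‖y‖ ≤ 9 * M}, ENNReal.ofReal (Φ (E4.ofTimeSpace (s + F y) y) ^ 2)) + (∫⁻ u in Set.Ioc 0 s, ∫⁻ y in {y : E3 | 15 *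 M / 2 ≤ ‖y‖ ∧ ‖y‖ ≤ 9 * M}, ENNReal.ofReal (Φ (E4.ofTimeSpace (u + F y) y) ^ 2)) + ENNReal.ofReal (M ^ 2) * (∫⁻ u in Set.Ioc 0 s, ∫⁻ y in {y : E3 | 2 * M < ‖y‖ ∧ ‖y‖ ≤ 9 * M}, ENNReal.ofReal (((1 - (Real.smoothTransition (2 - Kerr.radius 0 (E4.ofTimeSpace (u + F y) y) / (8 * M)) * (2 * Kerr.scalarH M 0 (E4.ofTimeSpace (u + F y) y)))) * (∑ i : Fin 3, (E4.ofTimeSpace (u + F y) y) i.succ * fderiv ℝ Φ (E4.ofTimeSpace (u + F y) y) (E4.basisVector i.succ)) / Kerr.radius 0 (E4.ofTimeSpace (u + F y) y) + (Real.smoothTransition (2 - Kerr.radius 0 (E4.ofTimeSpace (u + F y) y) / (8 * M)) * (2 * Kerr.scalarH M 0 (E4.ofTimeSpace (u + F y) y))) * fderiv ℝ Φ (E4.ofTimeSpace (u + F y) y) (E4.basisVector 0)) ^ 2 + fderiv ℝ Φ (E4.ofTimeSpace (u + F y) y) (E4.basisVector 0) ^ 2))) := by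
  intro M hM
  refine ⟨700, fun F Φ s hF hdF hΦ hs ↦ ?_⟩
  have h9M : (0 : ℝ) < 9 * M := by positivity
  -- ### notation: leaves, densities, regions, right-hand integrals
  set L : ℝ → E3 → E4 := fun u y ↦ E4.ofTimeSpace (u + F y) y with hL
  set P2 : E4 → ℝ := fun x ↦ Φ x ^ 2 with hP2
  set Sx : E4 → ℝ := fun x ↦ ∑ i : Fin 3, x i.succ * fderiv ℝ Φ x (E4.basisVector i.succ) with hSx
  set Dd : E4 → ℝ := fun x ↦ ((1 - (Real.smoothTransition (2 - Kerr.radius 0 x / (8 * M)) *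
    (2 * Kerr.scalarH M 0 x))) * (∑ i : Fin 3, x i.succ * fderiv ℝ Φ x (E4.basisVector i.succ)) /
    Kerr.radius 0 x + (Real.smoothTransition (2 - Kerr.radius 0 x / (8 * M)) *
    (2 * Kerr.scalarH M 0 x)) * fderiv ℝ Φ x (E4.basisVector 0)) ^ 2 +
    fderiv ℝ Φ x (E4.basisVector 0) ^ 2 with hDd
  set S9 : Set E3 := {y : E3 | 2 * M < ‖y‖ ∧ ‖y‖ ≤ 9 * M} with hS9
  set Sfar : Set E3 := {y : E3 | 15 * M / 2 ≤ ‖y‖ ∧ ‖y‖ ≤ 9 * M} with hSfar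
  set Score : Set E3 := {y : E3 | 2 * M < ‖y‖ ∧ ‖y‖ ≤ 15 * M / 2} with hScore
  set I₀ : ℝ≥0∞ := ∫⁻ y in S9, ENNReal.ofReal (P2 (L 0 y)) with hI₀
  set Is : ℝ≥0∞ := ∫⁻ y in S9, ENNReal.ofReal (P2 (L s y)) with hIs
  set Ifar : ℝ≥0∞ := ∫⁻ u in Ioc 0 s, ∫⁻ y in Sfar, ENNReal.ofReal (P2 (L u y)) with hIfar
  set Ider : ℝ≥0∞ := ∫⁻ u in Ioc 0 s, ∫⁻ y in S9, ENNReal.ofReal (Dd (L u y)) with hIder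
  set Rhs : ℝ≥0∞ := ENNReal.ofReal M * I₀ + ENNReal.ofReal M * Is + Ifar +
    ENNReal.ofReal (M ^ 2) * Ider with hRhs
  show ∫⁻ u in Ioc 0 s, ∫⁻ y in Score, ENNReal.ofReal (P2 (L u y)) ≤ ((700 : NNReal) : ℝ≥0∞) * Rhs
  rw [ENNReal.coe_ofNat]
  -- ### the trivial case of an infinite right-hand side
  rcases eq_or_ne Rhs ∞ with htop | htop
  · rw [htop, ENNReal.mul_top (by norm_num)]
    exact le_top
  -- ### the transport field and the densities
  set θf : E4 → ℝ := fun x ↦ Real.smoothTransition (6 - 2 * Kerr.radius 0 x / (3 * M)) with hθf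
  set hf : E4 → ℝ := fun x ↦ 2 * (Kerr.radius 0 x - 2 * M) *
    Real.smoothTransition (6 - 2 * Kerr.radius 0 x / (3 * M)) * Φ x ^ 2 with hhf
  set divV : E4 → ℝ := fun x ↦ ∑ μ, fderiv ℝ (fun z : E4 ↦ if μ = 0 then (0 : ℝ) else
    hf z * z μ / E4.spatialNorm z) x (E4.basisVector μ) with hdivV
  set b : E4 → ℝ := fun x ↦ θf x * Φ x ^ 2 with hb
  set bad₁ : E4 → ℝ := fun x ↦ 2 * (Kerr.radius 0 x - 2 * M) *
    |deriv Real.smoothTransition (6 - 2 * Kerr.radius 0 x / (3 * M)) * (-(2 / (3 * M)))| *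
      Φ x ^ 2 with hbad₁
  set bad₂ : E4 → ℝ := fun x ↦ 4 * θf x *
    ((Kerr.radius 0 x - 2 * M) * Sx x / Kerr.radius 0 x) ^ 2 with hbad₂
  set w : ℝ → E4 → ℝ := fun ε x ↦ Real.smoothTransition (Kerr.horizonFn M 0 x / ε - 1) *
    Real.smoothTransition (2 - E4.spatialNorm x ^ 2 / (9 * M) ^ 2) with hw
  have hLrad : ∀ u y, Kerr.radius 0 (L u y) = ‖y‖ := fun u y ↦ by
    rw [Kerr.radius_zero_left]
    exact E4.spatialNorm_ofTimeSpace _ _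
  -- the pointwise facts at the points with `r > 2M` (`zeroth_transport_pointwise`)
  have hB := fun (x : E4) (hx : 2 * M < Kerr.radius 0 x) ↦ zeroth_transport_pointwise M Φ x hM hΦ hx
  have hpt : ∀ x, 2 * M < Kerr.radius 0 x → b x ≤ divV x + bad₁ x + bad₂ x := fun x hx ↦ (hB x hx).1
  -- the transport function: `C¹` at `r > 2M`, non-negative, zero for `‖x⃗‖ ≥ 9M`
  have hh1 : ∀ x : E4, 2 * M < Kerr.radius 0 x → ContDiffAt ℝ 1 hf x := fun x hx ↦
    (hB x hx).2.2.2.2.2.2.1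
  have hh0 : ∀ x : E4, 2 * M < E4.spatialNorm x → E4.spatialNorm x ≤ 2 * M + M / 8 →
      0 ≤ hf x := fun x hx _ ↦ by
    rw [← Kerr.radius_zero_left] at hx
    exact mul_nonneg (mul_nonneg (by linarith) (Real.smoothTransition.nonneg _)) (sq_nonneg _)
  have hh9 : ∀ x : E4, 9 * M ≤ E4.spatialNorm x → hf x = 0 := fun x hx ↦ by
    rw [← Kerr.radius_zero_left] at hx
    have h0 := (hB x (by linarith)).2.2.2.2.2.1 hx
    show 2 * (Kerr.radius 0 x - 2 * M) *
      Real.smoothTransition (6 - 2 * Kerr.radius 0 x / (3 * M)) * Φ x ^ 2 = 0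
    rw [h0, mul_zero, zero_mul]
  -- continuity of the densities at the points with `r > 2M`
  have hradc : Continuous (Kerr.radius 0) := Kerr.continuous_radius 0
  have hθc : Continuous θf := Real.smoothTransition.continuous.comp
    (continuous_const.sub ((continuous_const.mul hradc).div_const _))
  have hbc : ∀ x : E4, 2 * M < Kerr.radius 0 x → ContinuousAt b x ∧ 0 ≤ b x := fun x _ ↦
    ⟨(hθc.mul (hΦ.continuous.pow 2)).continuousAt,
      mul_nonneg (Real.smoothTransition.nonneg _) (sq_nonneg _)⟩
  have hdivc : ∀ x : E4, 2 * M < Kerr.radius 0 x → ContinuousAt divV x := fun x hx ↦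
    (hB x hx).2.2.2.2.2.2.2
  have hbad₁c : ∀ x : E4, 2 * M < Kerr.radius 0 x → ContinuousAt bad₁ x := fun x _ ↦ by
    have hd : Continuous (deriv Real.smoothTransition) :=
      (Real.smoothTransition.contDiff (n := 1)).continuous_deriv le_rfl
    exact (((continuous_const.mul (hradc.sub continuous_const)).mul
      ((hd.comp (continuous_const.sub ((continuous_const.mul hradc).div_const _))).mul
        continuous_const).abs).mul (hΦ.continuous.pow 2)).continuousAt
  have hSc : Continuous Sx := continuous_finsetSum _ fun i _ ↦
    (Kerr.contDiff_coord (Fin.succ i) (n := 0)).continuous.mul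
      ((hΦ.continuous_fderiv one_ne_zero).clm_apply continuous_const)
  have hbad₂c : ∀ x : E4, 2 * M < Kerr.radius 0 x → ContinuousAt bad₂ x := fun x hx ↦
    (continuous_const.mul hθc).continuousAt.mul ((((hradc.sub continuous_const).mul
      hSc).continuousAt.div hradc.continuousAt (lt_trans (by positivity) hx).ne').pow 2)
  -- ### the weighted slab inequality, for every admissible `ε`
  have hA : ∀ ε : ℝ, 0 < ε → 16 * ε * Real.exp ((s + |F 0| + 2 * (9 * M)) / (2 * M)) ≤ M →
      ∫ u in Set.Ioc 0 s, ∫ y : E3, (Real.smoothTransition (Kerr.horizonFn M 0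
        (E4.ofTimeSpace (u + F y) y) / ε - 1) * Real.smoothTransition (2 - E4.spatialNorm
        (E4.ofTimeSpace (u + F y) y) ^ 2 / (9 * M) ^ 2)) * b (E4.ofTimeSpace (u + F y) y) ≤
        700 * Rhs.toReal := by
    intro ε hε h16
    have hwm : ∀ x, 0 ≤ w ε x ∧ w ε x ≤ 1 := fun x ↦
      ⟨mul_nonneg (Real.smoothTransition.nonneg _) (Real.smoothTransition.nonneg _),
        mul_le_one₀ (Real.smoothTransition.le_one _) (Real.smoothTransition.nonneg _)
          (Real.smoothTransition.le_one _)⟩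
    have hwr : ∀ x, w ε x ≠ 0 → 2 * M < Kerr.radius 0 x := fun x hx ↦ by
      rw [← Kerr.rPlus_zero_right hM.le]
      exact Kerr.rPlus_lt_radius_of_horizonFn_pos
        (hε.trans (Kerr.lt_horizonFn_of_weight_ne_zero hε (left_ne_zero_of_mul hx)))
    -- the transport-field inequality between the boundary leaves
    have hRF : ∫ u in Ioc 0 s, ∫ y : E3, w ε (L u y) * divV (L u y) ≤
        2⁻¹ * (∫ y : E3, w ε (L 0 y) * |hf (L 0 y)|) +
          2⁻¹ * (∫ y : E3, w ε (L s y) * |hf (L s y)|) :=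
      radialField_weighted_graph_le M ε (9 * M) F hf s hM hε h9M h16 hF hdF hs hh1 hh0 hh9
    -- the pointwise inequality on the leaves, multiplied by the weight
    have hpt' : ∀ u y, w ε (L u y) * b (L u y) ≤ w ε (L u y) * divV (L u y) +
        w ε (L u y) * bad₁ (L u y) + w ε (L u y) * bad₂ (L u y) := by
      intro u y
      rcases eq_or_ne (w ε (L u y)) 0 with h0 | h0
      · rw [h0]
        simp
      · have h := mul_le_mul_of_nonneg_left (hpt _ (hwr _ h0)) (hwm (L u y)).1
        rwa [mul_add, mul_add] at h
    -- integrability on the leaves and across the slab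
    obtain ⟨hib, hIb⟩ : (∀ u, Integrable fun y ↦ w ε (L u y) * b (L u y)) ∧
        IntegrableOn (fun u ↦ ∫ y, w ε (L u y) * b (L u y)) (Ioc 0 s) :=
      zeroth_leafIntegral (R := 9 * M) hM hε h9M hF.continuous (P := b) (fun x hx ↦ (hbc x hx).1) s
    obtain ⟨hid, hId⟩ : (∀ u, Integrable fun y ↦ w ε (L u y) * divV (L u y)) ∧
        IntegrableOn (fun u ↦ ∫ y, w ε (L u y) * divV (L u y)) (Ioc 0 s) :=
      zeroth_leafIntegral (R := 9 * M) hM hε h9M hF.continuous (P := divV) hdivc s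
    obtain ⟨hi1, hI1⟩ : (∀ u, Integrable fun y ↦ w ε (L u y) * bad₁ (L u y)) ∧
        IntegrableOn (fun u ↦ ∫ y, w ε (L u y) * bad₁ (L u y)) (Ioc 0 s) :=
      zeroth_leafIntegral (R := 9 * M) hM hε h9M hF.continuous (P := bad₁) hbad₁c s
    obtain ⟨hi2, hI2⟩ : (∀ u, Integrable fun y ↦ w ε (L u y) * bad₂ (L u y)) ∧
        IntegrableOn (fun u ↦ ∫ y, w ε (L u y) * bad₂ (L u y)) (Ioc 0 s) :=
      zeroth_leafIntegral (R := 9 * M) hM hε h9M hF.continuous (P := bad₂) hbad₂c s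
    -- integrate in `y`, then in `u`
    have hinner : ∀ u, ∫ y, w ε (L u y) * b (L u y) ≤ (∫ y, w ε (L u y) * divV (L u y)) +
        (∫ y, w ε (L u y) * bad₁ (L u y)) + ∫ y, w ε (L u y) * bad₂ (L u y) := by
      intro u
      have h12 : Integrable fun y ↦ w ε (L u y) * divV (L u y) + w ε (L u y) * bad₁ (L u y) :=
        (hid u).add (hi1 u)
      rw [← integral_add (hid u) (hi1 u), ← integral_add h12 (hi2 u)]
      exact integral_mono (hib u) (h12.add (hi2 u)) (hpt' u)
    have houter : ∫ u in Ioc 0 s, ∫ y, w ε (L u y) * b (L u y) ≤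
        (∫ u in Ioc 0 s, ∫ y, w ε (L u y) * divV (L u y)) +
          (∫ u in Ioc 0 s, ∫ y, w ε (L u y) * bad₁ (L u y)) +
          ∫ u in Ioc 0 s, ∫ y, w ε (L u y) * bad₂ (L u y) := by
      have h12 : IntegrableOn (fun u ↦ (∫ y, w ε (L u y) * divV (L u y)) +
          ∫ y, w ε (L u y) * bad₁ (L u y)) (Ioc 0 s) := hId.add hI1
      rw [← integral_add hId hI1, ← integral_add h12 hI2]
      exact setIntegral_mono hIb (h12.add hI2) hinner
    -- ### domination of the right-hand real integrals by the Lebesgue integrals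
    have key : ∀ (X : ℝ) (c I : ℝ≥0∞), c ≠ ∞ → I ≤ Rhs → ENNReal.ofReal X ≤ c * I →
        X ≤ c.toReal * Rhs.toReal := by
      intro X c I hc hI h
      rw [← ENNReal.toReal_mul]
      exact (ENNReal.ofReal_le_iff_le_toReal (ENNReal.mul_ne_top hc htop)).mp
        (h.trans (mul_le_mul' le_rfl hI))
    -- the two boundary terms: `Wt |h| ≤ 14 M Φ² 𝟙_{2M < ‖y‖ ≤ 9M}`
    have hflux : ∀ t : ℝ, ENNReal.ofReal M * (∫⁻ y in S9, ENNReal.ofReal (P2 (L t y))) ≤ Rhs →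
        (∫ y, w ε (L t y) * |hf (L t y)|) ≤ 14 * Rhs.toReal := by
      intro t ht
      have h1 : ENNReal.ofReal (∫ y, w ε (L t y) * |hf (L t y)|) ≤
          ENNReal.ofReal (14 * M) * ∫⁻ y in S9, ENNReal.ofReal (P2 (L t y)) := by
        refine zeroth_ofReal_integral_le_mul (by positivity) (fun y hy ↦ ?_) (fun y hy ↦ ?_)
        · have hr : 2 * M < Kerr.radius 0 (L t y) := by
            rw [hLrad]
            exact hy.1
          have hb := (hB _ hr).2.2.2.1
          rw [if_pos (by rw [hLrad]; exact hy.2)] at hb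
          calc w ε (L t y) * |hf (L t y)| ≤ 1 * (14 * M * Φ (L t y) ^ 2) :=
                mul_le_mul (hwm _).2 hb (abs_nonneg _) zero_le_one
            _ = 14 * M * P2 (L t y) := one_mul _
        · rcases eq_or_ne (w ε (L t y)) 0 with h0 | h0
          · rw [h0, zero_mul]
          · have hr := hwr _ h0
            have hb := (hB _ hr).2.2.2.1
            rw [if_neg (fun hle ↦ hy ⟨by rwa [hLrad] at hr, by rwa [hLrad] at hle⟩)] at hb
            exact mul_nonpos_of_nonneg_of_nonpos (hwm _).1 hb
      have h := key _ 14 _ (by norm_num) ht (by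
        rw [← mul_assoc, ← ENNReal.ofReal_ofNat 14, ← ENNReal.ofReal_mul (by norm_num)]
        exact h1)
      rwa [ENNReal.toReal_ofNat] at h
    have hX₁ := hflux 0 (le_add_right (le_add_right (le_add_right le_rfl)))
    have hX₂ := hflux s (le_add_right (le_add_right (le_add_left le_rfl)))
    -- the cut-off error: `Wt bad₁ ≤ 38 Φ² 𝟙_{15M/2 ≤ ‖y‖ ≤ 9M}`
    have hX₃ : (∫ u in Ioc 0 s, ∫ y, w ε (L u y) * bad₁ (L u y)) ≤ 38 * Rhs.toReal := by
      have h3 : ENNReal.ofReal (∫ u in Ioc 0 s, ∫ y, w ε (L u y) * bad₁ (L u y)) ≤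
          ENNReal.ofReal 38 * Ifar := by
        refine zeroth_ofReal_slabIntegral_le_mul (by norm_num) (fun u y hy ↦ ?_)
          (fun u y hy ↦ ?_) s
        · have hr : 2 * M < Kerr.radius 0 (L u y) := by
            rw [hLrad]
            linarith [hy.1]
          have hb := (hB _ hr).2.1
          rw [if_pos (by rw [hLrad]; exact hy)] at hb
          have hbad0 : 0 ≤ bad₁ (L u y) :=
            mul_nonneg (mul_nonneg (by linarith) (abs_nonneg _)) (sq_nonneg _)
          calc w ε (L u y) * bad₁ (L u y) ≤ 1 * bad₁ (L u y) :=
                mul_le_mul_of_nonneg_right (hwm _).2 hbad0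
            _ ≤ 38 * P2 (L u y) := by
                rw [one_mul]
                exact mul_le_mul_of_nonneg_right hb (sq_nonneg _)
        · rcases eq_or_ne (w ε (L u y)) 0 with h0 | h0
          · rw [h0, zero_mul]
          · have hb := (hB _ (hwr _ h0)).2.1
            rw [if_neg (by rw [hLrad]; exact hy)] at hb
            exact mul_nonpos_of_nonneg_of_nonpos (hwm _).1
              (mul_nonpos_of_nonpos_of_nonneg hb (sq_nonneg _))
      have h := key _ 38 Ifar (by norm_num) (le_add_right (le_add_left le_rfl))
        (by rwa [ENNReal.ofReal_ofNat] at h3)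
      rwa [ENNReal.toReal_ofNat] at h
    -- the radial-derivative error: `Wt bad₂ ≤ 648 M² ((∂_{r*}Φ)² + (∂₀Φ)²) 𝟙_{2M < ‖y‖ ≤ 9M}`
    have hX₄ : (∫ u in Ioc 0 s, ∫ y, w ε (L u y) * bad₂ (L u y)) ≤ 648 * Rhs.toReal := by
      have h4 : ENNReal.ofReal (∫ u in Ioc 0 s, ∫ y, w ε (L u y) * bad₂ (L u y)) ≤
          ENNReal.ofReal (648 * M ^ 2) * Ider := by
        refine zeroth_ofReal_slabIntegral_le_mul (by positivity) (fun u y hy ↦ ?_)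
          (fun u y hy ↦ ?_) s
        · have hr : 2 * M < Kerr.radius 0 (L u y) := by
            rw [hLrad]
            exact hy.1
          have hb := (hB _ hr).2.2.1 (Sx (L u y)) (fderiv ℝ Φ (L u y) (E4.basisVector 0))
          rw [if_pos (by rw [hLrad]; exact hy.2)] at hb
          have hbad0 : 0 ≤ bad₂ (L u y) :=
            mul_nonneg (mul_nonneg (by norm_num) (Real.smoothTransition.nonneg _)) (sq_nonneg _)
          calc w ε (L u y) * bad₂ (L u y) ≤ 1 * bad₂ (L u y) :=
                mul_le_mul_of_nonneg_right (hwm _).2 hbad0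
            _ ≤ 648 * M ^ 2 * Dd (L u y) := by
                rw [one_mul]
                exact hb
        · rcases eq_or_ne (w ε (L u y)) 0 with h0 | h0
          · rw [h0, zero_mul]
          · have hr := hwr _ h0
            have hb := (hB _ hr).2.2.1 (Sx (L u y)) (fderiv ℝ Φ (L u y) (E4.basisVector 0))
            rw [if_neg (fun hle ↦ hy ⟨by rwa [hLrad] at hr, by rwa [hLrad] at hle⟩)] at hb
            exact mul_nonpos_of_nonneg_of_nonpos (hwm _).1 hb
      have h := key _ 648 (ENNReal.ofReal (M ^ 2) * Ider) (by norm_num) (le_add_left le_rfl) (by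
        rw [← mul_assoc, ← ENNReal.ofReal_ofNat 648, ← ENNReal.ofReal_mul (by norm_num)]
        exact h4)
      rwa [ENNReal.toReal_ofNat] at h
    -- ### assembly of the weighted inequality
    show ∫ u in Ioc 0 s, ∫ y, w ε (L u y) * b (L u y) ≤ 700 * Rhs.toReal
    linarith [houter, hRF, hX₁, hX₂, hX₃, hX₄]
  -- ### removing the weight, and `θ = 1` on the core
  have hSm : MeasurableSet Score :=
    (isOpen_lt continuous_const continuous_norm).measurableSet.inter
      (isClosed_le continuous_norm continuous_const).measurableSet
  calc ∫⁻ u in Ioc 0 s, ∫⁻ y in Score, ENNReal.ofReal (P2 (L u y))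
      = ∫⁻ u in Ioc 0 s, ∫⁻ y in Score, ENNReal.ofReal (b (L u y)) := by
        refine lintegral_congr fun u ↦ setLIntegral_congr_fun hSm fun y hy ↦ ?_
        have hr : 2 * M < Kerr.radius 0 (L u y) := by
          rw [hLrad]
          exact hy.1
        show ENNReal.ofReal (Φ (L u y) ^ 2) = ENNReal.ofReal
          (Real.smoothTransition (6 - 2 * Kerr.radius 0 (L u y) / (3 * M)) * Φ (L u y) ^ 2)
        rw [(hB _ hr).2.2.2.2.1 (by rw [hLrad]; exact hy.2), one_mul]
    _ ≤ ∫⁻ u in Ioc 0 s, ∫⁻ y in S9, ENNReal.ofReal (b (L u y)) :=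
        lintegral_mono fun u ↦ lintegral_mono_set fun y hy ↦ ⟨hy.1, hy.2.trans (by linarith)⟩
    _ ≤ ENNReal.ofReal (700 * Rhs.toReal) :=
        slab_lintegral_le_of_weighted_le M (9 * M) F b s (700 * Rhs.toReal) hM h9M hF.continuous
          hs hbc hA
    _ = 700 * Rhs := by
        rw [ENNReal.ofReal_mul (by norm_num), ENNReal.ofReal_toReal htop, ENNReal.ofReal_ofNat]

end Summit.FinalStateConjecture.FinalStateConjecture.Theorems

end
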